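import Literature.Claims.NS.Ramm2019
import Literature.Analysis.FluidPDE.TaoH1LocalExistenceProofs
import Literature.Analysis.FluidPDE.CheskidovShvydkoyRegularProofs
import Literature.Analysis.FluidPDE.TaoFiniteEnergyLerayHopf
import Literature.Analysis.FluidPDE.LerayHopfMild
import Summits.NavierStokesRegularity.NavierStokesRegularity.Theorems.SoloRefuteRamm2024Grad
import HarnessLib

/-!
# Salvage C04b `Ramm2019` — the TRUE typed step: local existence in `X` (Step 7)

Cell ns-claims (D-0090), salvage seat ns-claims-salvage-p1. The typed skeleton
`Literature.Claims.NS.Ramm2019` (A. G. Ramm, Appl. Math. Lett. 87 (2019) 160–164 =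
arXiv:1904.11569v1) asserts in Step 7 (§3 l.324–365, the contraction part of Theorem 2): for
`ν > 0` and a smooth, rapidly decaying, divergence-free datum there are `τ > 0` and an `X`-solution
on `[0,τ]` — `X = C([0,τ]; L²(ℝ³))`, solutions of the integral equation (e2) in the tree's duality
(mild) form with `v(0) = v₀`. This is TRUE and classical; here it is discharged in the kernel from
Tao's smooth `H¹` local existence theorem (tree fact `tao2011_smooth_local_existence`, proved:
`tao2011_smooth_local_existence_holds`) and the finite-energy ⇒ Leray–Hopf ⇒ mild bridges of the
tree (`isLerayHopfOn_of_finiteEnergy`, `IsLerayHopfOn.isMildNSSolutionOn_Ioc`):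

* `inX_of_classical` — a classical solution on the closed slab `[0,T]` with bounded Sobolev norms
  and `u 0 = u₀ ∈ 𝒮` is an `X`-solution on `[0,T]`;
* `step7_localExistence_holds : Literature.Claims.NS.Ramm2019.Step7_localExistence`.

(Step 1 — the energy inequality for ALL `X`-solutions — is not dischargeable as typed: the class
`X` carries no energy inequality; see the cell's `claims/Ramm2019/SALVAGE.md`.)

WHAT THIS IS NOT: not a claim about NS regularity or blow-up; not a claim about any author beyond the
typed locator.
-/

noncomputable section

set_option linter.dupNamespace false

open MeasureTheory Set Filter Function
open scoped ENNReal NNReal ContDiff Topology RealInnerProductSpace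

namespace Summit.NavierStokesRegularity.NavierStokesRegularity.Theorems.Ramm2019

open Literature.Claims.NS.Ramm2019 Literature.Analysis.FluidPDE

/-- **A smooth finite-energy solution on the closed slab is an `X`-solution.** A classical solution
`(u,p)` of the unforced system on `[0,T]`, `T > 0`, with `u 0 = u₀`, `u₀` smooth and rapidly
decaying, and `sup_{[0,T]} ‖u(t)‖₂² < ∞`, satisfies `InX ν u₀ T u`: it is Leray–Hopf and
`L²`-continuous on `[0,T]` (Tao 2013 L8.1, tree `isLerayHopfOn_of_finiteEnergy`), hence a mild
solution on `(0,T]` (Fabes–Jones–Rivière, tree `IsLerayHopfOn.isMildNSSolutionOn_Ioc`), and the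
`t = 0` identity is `u 0 = u₀`. [cite: Tao2011, Lemma 8.1; FabesJonesRiviere1972, Thm. 2.1] -/
theorem inX_of_classical {ν T : ℝ} {u₀ : EuclideanSpace ℝ (Fin 3) → EuclideanSpace ℝ (Fin 3)}
    {u : ℝ → EuclideanSpace ℝ (Fin 3) → EuclideanSpace ℝ (Fin 3)}
    {p : ℝ → EuclideanSpace ℝ (Fin 3) → ℝ} (hν : 0 < ν) (hT : 0 < T)
    (hsol : IsClassicalNSSolutionOn (Icc 0 T) ν 0 u p) (hu0 : u 0 = u₀) (hsm : ContDiff ℝ ∞ u₀)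
    (hdec : HasRapidSpatialDecay u₀)
    (hfe : ∃ A : ℝ≥0∞, A < ⊤ ∧ ∀ t ∈ Icc 0 T, ∫⁻ x, ‖u t x‖ₑ ^ 2 ≤ A) :
    InX ν u₀ T u := by
  obtain ⟨hLH, hcont⟩ := isLerayHopfOn_of_finiteEnergy hsol hν hT hfe
  rw [hu0] at hLH
  have hE3 : Module.finrank ℝ (EuclideanSpace ℝ (Fin 3)) = 3 := by
    rw [finrank_euclideanSpace, Fintype.card_fin]
  have hu₀ : MemLp u₀ 2 volume := Ramm2024.memLp_two_of_decay hsm hdec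
  have hmild := hLH.isMildNSSolutionOn_Ioc hE3 hu₀ hν hT
  refine ⟨⟨fun t ht => ?_, fun t ht => ?_⟩, hcont, hu0⟩
  · rcases ht.1.eq_or_lt with h | hpos
    · subst h
      rw [hu0]
      exact VectorCalculus.IsDivFree.isWeaklyDivFree_holds
        (by rw [← hu0]; exact hsol.divFree 0 ⟨le_rfl, hT.le⟩) (contDiff_infty.1 hsm 1)
    · exact hmild.1 t ⟨hpos, ht.2⟩
  · rcases ht.1.eq_or_lt with h | hpos
    · subst h
      rw [isMildNSSolutionFrom_zero_iff]
      intro φ _ _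
      rw [hu0]
    · exact hmild.2 t ⟨hpos, ht.2⟩

/-- **Step 7 of the typed skeleton is TRUE (kernel):** for `ν > 0` and a smooth, rapidly decaying,
divergence-free datum there are `τ > 0` and an `X`-solution on `[0,τ]` — Tao's `H¹` local existence
theorem (2013, Thm. 5.4 (ii)+(iv); tree `tao2011_smooth_local_existence_holds`) on
`[0,τ]`, `τ = cν³/(A² + 1)`, `A = ‖u₀‖²₂ + ‖∇u₀‖²₂`, followed by `inX_of_classical`. The printed
proof (§3 (e13a)–(e17), contraction of `B` on a ball of `X` for small `τ`) is not used.
[cite: Ramm2019, Thm 2, §3 l.324–365 of arXiv:1904.11569v1; Tao2011, Thm. 5.4] -/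
theorem step7_localExistence_holds : Step7_localExistence := by
  intro ν u₀ hD
  have hν := hD.viscosity_pos
  have hsm := hD.data_smooth
  have hdec := hD.data_decay
  obtain ⟨c, hc, hloc⟩ := tao2011_smooth_local_existence_holds
  have hHinf : ∀ n : ℕ, ∫⁻ x, ‖iteratedFDeriv ℝ n u₀ x‖ₑ ^ 2 < ⊤ :=
    hdec.lintegral_enorm_iteratedFDeriv_sq_lt_top
  have h0 : ∫⁻ x, ‖u₀ x‖ₑ ^ 2 < ⊤ := by
    refine lt_of_le_of_lt (le_of_eq (lintegral_congr fun x => ?_)) (hHinf 0)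
    rw [← ofReal_norm, ← ofReal_norm, norm_iteratedFDeriv_zero]
  have h1 : ∫⁻ x, ENNReal.ofReal (frobeniusNormSq (fderiv ℝ u₀ x)) < ⊤ := by
    refine lt_of_le_of_lt ?_ (ENNReal.mul_lt_top (by simp : (3 : ℝ≥0∞) < ⊤) (hHinf 1))
    calc ∫⁻ x, ENNReal.ofReal (frobeniusNormSq (fderiv ℝ u₀ x))
        ≤ ∫⁻ x, 3 * ‖iteratedFDeriv ℝ 1 u₀ x‖ₑ ^ 2 := lintegral_mono fun x => by
          rw [← ofReal_norm, norm_iteratedFDeriv_one, ofReal_norm]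
          exact ofReal_frobeniusNormSq_le_three_mul_enorm_sq _
      _ = 3 * ∫⁻ x, ‖iteratedFDeriv ℝ 1 u₀ x‖ₑ ^ 2 := lintegral_const_mul' _ _ (by simp)
  set A : ℝ := ((∫⁻ x, ‖u₀ x‖ₑ ^ 2) +
    ∫⁻ x, ENNReal.ofReal (frobeniusNormSq (fderiv ℝ u₀ x))).toReal with hA
  have hA0 : 0 ≤ A := ENNReal.toReal_nonneg
  have hAeq : (∫⁻ x, ‖u₀ x‖ₑ ^ 2) + ∫⁻ x, ENNReal.ofReal (frobeniusNormSq (fderiv ℝ u₀ x))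
      ≤ ENNReal.ofReal A := by
    rw [hA, ENNReal.ofReal_toReal (ENNReal.add_ne_top.2 ⟨h0.ne, h1.ne⟩)]
  set T : ℝ := c * ν ^ 3 / (A ^ 2 + 1) with hT
  have hTpos : 0 < T := by positivity
  have hTc : A ^ 2 * T ≤ c * ν ^ 3 := by
    calc A ^ 2 * T = c * ν ^ 3 * (A ^ 2 / (A ^ 2 + 1)) := by rw [hT]; ring
      _ ≤ c * ν ^ 3 * 1 :=
          mul_le_mul_of_nonneg_left (by rw [div_le_one (by positivity)]; linarith) (by positivity)
      _ = c * ν ^ 3 := mul_one _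
  have hdiv' : VectorCalculus.IsDivFree u₀ := fun x => hD.data_divFree x
  obtain ⟨u, p, hsol, hu0, hub, -, -, -⟩ := hloc hν hTpos hsm hdiv' hHinf hA0 hAeq hTc
  -- finite energy on the closed slab from the `n = 0` Sobolev bound
  have hfe : ∃ B : ℝ≥0∞, B < ⊤ ∧ ∀ t ∈ Icc 0 T, ∫⁻ x, ‖u t x‖ₑ ^ 2 ≤ B := by
    obtain ⟨C, hC⟩ := hub 0
    refine ⟨C, ENNReal.coe_lt_top, fun t ht => ?_⟩
    refine le_trans (le_of_eq (lintegral_congr fun x => ?_)) (hC t ht)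
    rw [← ofReal_norm, ← ofReal_norm, norm_iteratedFDeriv_zero]
  exact ⟨T, hTpos, u, inX_of_classical hν hTpos hsol hu0 hsm hdec hfe⟩

end Summit.NavierStokesRegularity.NavierStokesRegularity.Theorems.Ramm2019

end
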